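import Summits.BirchSwinnertonDyer.BirchSwinnertonDyer.Theorems.KolyvaginDepthDoorDepthTableRankTwo664a1TwistBSDQuotient
import Summits.BirchSwinnertonDyer.BirchSwinnertonDyer.Theorems.KolyvaginDepthDoorDepthTableRow664a1RankDischarged
import Summits.BirchSwinnertonDyer.BirchSwinnertonDyer.Theorems.KolyvaginDepthDoorDepthTableRankTwo916c1TwistBSDQuotient
import Summits.BirchSwinnertonDyer.BirchSwinnertonDyer.Theorems.KolyvaginDepthDoorDepthTableRow916c1RankDischarged
import Summits.BirchSwinnertonDyer.BirchSwinnertonDyer.Theorems.KolyvaginDepthDoorDepthTableRankTwo944e1TwistBSDQuotient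
import Summits.BirchSwinnertonDyer.BirchSwinnertonDyer.Theorems.KolyvaginDepthDoorDepthTableRow944e1RankDischarged
import Summits.BirchSwinnertonDyer.BirchSwinnertonDyer.Theorems.KolyvaginDepthDoorDepthTableRowsIntrinsic5
import Summits.BirchSwinnertonDyer.BirchSwinnertonDyer.Theorems.KolyvaginDepthDoorKNSupplyExactReadingDepthRow
import Summits.BirchSwinnertonDyer.BirchSwinnertonDyer.Theorems.KolyvaginDepthDoorDepthTableIntrinsicExact
import HarnessLib

/-!
# Route `KolyvaginDepthDoor`, crux `KolyvaginDepthSupplyKN` (stmt-BirchSwinnertonDyer-22820) —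
# DEPTH TABLE v16: the EXACT rows `664a1`, `916c1`, `944e1` INTRINSIC — «one Kolyvagin bit ⟺ the BSD quotient of the Heegner twist is a `p`-adic unit»,
# for EVERY Heegner field `K` and EVERY admissible prime `p`; the SPLIT cell (Castella–Sano supply)

Helper file of the lead prover of line `levelone` (kdd-p1 g20; `--supports stmt-BirchSwinnertonDyer-22820
--as helper`); it closes nothing and BSD is NOT proved by it.

g19's exact rows were stated at `p = 5` and the Heegner field of record on a kernel-certified minimal twist model carrying Kodaira–Néron.
Here (generic `exactRow_iff_bsdQuotient_unit_intrinsic_{spade,split}`): for each rank-TWO curve below (rank `= 2` by the tree's kernel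
2-descent `Rank2Observatory.C<label>.mordellWeilRank_eq_two`), for EVERY admissible `5 ≤ p < 1000` (good ordinary, `ρ_{E,p^n}` onto —
hypotheses), EVERY admissible Heegner field `K` and ANY globally minimal model `T` of `E^{(d_K)}` with `ord_{s=1} L(E^{(d_K)}, s) = 1`:

  «∃ frame, Kolyvagin prime `ℓ`, datum of conductor `ℓ` with `c_1(ℓ) ≠ 0`»  `↔`  «`∃ q : ℚ`, `L'(T,1)/(Ω_T·Reg_T) = q ∧ ord_p q = 0`».

One Jetchev–Lauter–Stein bit at `(E, p, K)` DECIDES the `p`-adic unit-ness of `#Ш_an·Tam` of the rank-one curve `E^{(d_K)}`, and conversely —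
at every `(p, K)` at once, with no certificate on the twist (its Tamagawa valuation is the curve's, Jetchev–Skinner–Wan (eq:tamK)).

CONDITIONAL on (γ) = Gross 1991 Prop. 3.7 (2), W. Zhang 2014 L8.4 (1) / 9.1 resp. Castella–Sano 2026 Thm. 3 + Zanarella 2019 + Howard–Zanarella +
modularity + Mazur 1978, Stein–Wuthrich 2013 Thm. 1.1, Burungale–Castella–Skinner 2025 Cor. 1.3.1 and GZK, BY NAME; per curve; nothing class-wide
(the open stub (S♭) is untouched); BSD is NOT proved by any of this.

References: [GrossLMS1991] Prop. 3.7 (2); [WZhang2014] L8.4 (1), Thm. 9.1; [CastellaSano2026] Thm. 3; [SteinWuthrich2013] Thm. 1.1;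
[BurungaleCastellaSkinner2025] Cor. 1.3.1; [JetchevSkinnerWan2017] §7.3.1; [JetchevLauterStein2009] §3.6; [CremonaAlgorithms1997] Table 1.
-/

set_option linter.dupNamespace false

noncomputable section

open scoped Classical NumberField

namespace Summit.BirchSwinnertonDyer.BirchSwinnertonDyer.Theorems.KolyvaginDepthDoor

open Literature.NumberTheory.EllipticCurves Literature.NumberTheory.EllipticCurves.ModularForms
  WeierstrassCurve NumberField IsDedekindDomain
open Summit.BirchSwinnertonDyer.BirchSwinnertonDyer.Theorems
open Summit.BirchSwinnertonDyer.BirchSwinnertonDyer.Rank2Observatory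
open Summit.BirchSwinnertonDyer.BirchSwinnertonDyer.Rank1Residual
open Summit.BirchSwinnertonDyer.Rank1Residual.Additive

/-- **THE INTRINSIC EXACT ROW ON THE SPLIT CELL (generic)** — as `exactRow_iff_bsdQuotient_unit_intrinsic_spade` with Castella–Sano's
supply (g14's `kolyvaginClass_prime_ne_zero_iff_shaTrivial_twistSelmer_of_rank_two_of_maninPrint`: `d_K` odd, `p` split in `K`, no ♠, any
conductor): for `W` globally minimal non-CM of Mordell–Weil rank `2` with `N_E ≤ 30 000`, `5 ≤ p < 1000` good ordinary, `ρ_{W,p^n}` onto,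
Kodaira–Néron, `K` imaginary quadratic Heegner (`d_K` odd, `∉ {−3,−4}`, `p ∤ d_K`, `p` split), `T` ANY globally minimal model of `E^{(d_K)}` with
`ord_{s=1} L(E^{(d_K)}, s) = 1`: «bit» `↔` «BSD quotient of `T` is a `p`-adic unit». CONDITIONAL on (γ), Castella–Sano Thm. 3, Zanarella
2.18, Howard–Zanarella, modularity, Mazur Cor. 4.1, Stein–Wuthrich Thm. 1.1, BCS Cor. 1.3.1, GZK by name; per `(W, p, K)`; BSD is not proved
by it. [cite: GrossLMS1991, Prop. 3.7 (2)] [cite: CastellaSano2026, Thm. 3] [cite: SteinWuthrich2013, Thm. 1.1 (p. 1758)]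
[cite: BurungaleCastellaSkinner2025, Cor. 1.3.1 (p. 4)] -/
theorem exactRow_iff_bsdQuotient_unit_intrinsic_split
    (h372 : GrossLMS1991.prop37_2_frobeniusCongruence)
    (h3 : Literature.NumberTheory.EllipticCurves.CastellaSano2026_kolyvaginClass_selmerDivisibility_eq_padicValNat_tamagawaProduct)
    (hZ : Literature.NumberTheory.EllipticCurves.Zanarella2019_kolyvaginClass_one_ne_zero_of_not_selmerDivisible)
    (hHZ : Literature.NumberTheory.EllipticCurves.HowardZanarella_exists_minimal_kolyvaginClass_one_selmerCard_of_ne_zero)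
    (hnf : exists_isNewformOf) (hMaz : mazur_not_dvd_maninConstant_of_odd)
    (hSW : SteinWuthrich2013_sha_inf_torsionBy_eq_bot_of_two_le_rank)
    (hBCS : BurungaleCastellaSkinner2025.cor131_padicValRat_bsd_rank_le_one)
    (hGZK : rank_eq_analyticRank_of_analyticRank_le_one)
    (W : WeierstrassCurve ℚ) [W.IsElliptic] [W.IsGloballyMinimal] (hcm : ¬ W.HasCM) (hr : W.mordellWeilRank = 2)
    (hN : W.conductorNorm ℤ ≤ 30000)
    (p : ℕ) [hp : Fact p.Prime] (h5 : 5 ≤ p) (hp1000 : p < 1000) (hgood : W.HasGoodReductionAtPrime p)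
    (hord : ¬ (p : ℤ) ∣ W.frobeniusTrace p)
    (htower : ∀ n : ℕ, W.HasSurjectiveModNGaloisRep (p ^ n : ℕ))
    (hKN : ∀ v : HeightOneSpectrum (𝓞 ℚ), W.HasMultiplicativeReductionAt v →
      ¬ p ∣ W.ordMinimalDiscriminant v)
    (K : Type) [Field K] [NumberField K] (hK : IsImaginaryQuadratic K)
    (hodd : Odd (NumberField.discr K)) (hD3 : NumberField.discr K ≠ -3) (hD4 : NumberField.discr K ≠ -4)
    (hpD : ¬ ((p : ℤ) ∣ NumberField.discr K)) (hspl : SatisfiesHeegnerHypothesis p K)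
    [NeZero (W.conductorNorm ℤ)] (hH : SatisfiesHeegnerHypothesis (W.conductorNorm ℤ) K)
    (T : WeierstrassCurve ℚ) [T.IsElliptic] [T.IsGloballyMinimal] (C : WeierstrassCurve.VariableChange ℚ)
    (hC : C • T = W.quadraticTwist (NumberField.discr K : ℚ))
    (hTr : (W.quadraticTwist (NumberField.discr K : ℚ)).analyticRank = 1) :
    (∃ (Dt : ModularParametrizationData W (W.conductorNorm ℤ)) (β : ℤ) (ι : K →+* ℂ) (ℓ : ℕ)
      (d : KolyvaginHeegnerData Dt β ι ℓ),
      ℓ.Prime ∧ Zhang2014.IsKolyvaginPrime (W.conductorNorm ℤ) W K p ℓ ∧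
        d.kolyvaginClass hp.out 1 ≠ 0) ↔
    ∃ q : ℚ, T.leadingLCoeff / ((T.realPeriodRat * T.regulator : ℝ) : ℂ) = (q : ℂ) ∧ padicValRat p q = 0 := by
  have hsur : W.HasSurjectiveModNGaloisRep p := by simpa only [pow_one] using htower 1
  have hsha : (W.sha ⊓ AddSubgroup.torsionBy W.galH1 (p : ℤ) : AddSubgroup W.galH1) = ⊥ :=
    hSW W hcm (by rw [hr]) hN p h5 hp1000 hgood hord hsur
  rw [kolyvaginClass_prime_ne_zero_iff_shaTrivial_twistSelmer_of_rank_two_of_maninPrint h372 h3 hZ hHZ hnf hMaz W hcm hr p h5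
    hgood hord htower hKN K hK hodd hD3 hD4 hpD hspl hH, and_iff_right hsha]
  exact twistSelmer_le_iff_bsdQuotient_unit_intrinsic hBCS hGZK W hcm p h5 hgood hord hsur hKN K hK hpD hH T C hC hTr

namespace C664a1

/-- **INTRINSIC EXACT ROW `664a1` ON THE SPLIT CELL — «ONE KOLYVAGIN BIT ⟺ THE BSD QUOTIENT OF THE HEEGNER TWIST IS A `p`-ADIC UNIT», for EVERY
Heegner field with odd `d_K` and EVERY admissible split prime (depth table v16).** `664a1` is additive at `2` (one multiplicative prime `83`): Castella–Sano
supply. For every `5 ≤ p < 1000` good ordinary with `ρ_{E,p^n}` onto, every imaginary quadratic `K` (`d_K` odd, `∉ {−3,−4}`, `p ∤ d_K`, `p` split,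
`2` and `83` split) and ANY globally minimal model `T` of `E^{(d_K)}` with `ord_{s=1} L(E^{(d_K)}, s) = 1`: «∃ frame, Kolyvagin prime `ℓ`, datum with
`c_1(ℓ) ≠ 0`» `↔` «`∃ q`, `L'(T,1)/(Ω_T·Reg_T) = q ∧ ord_p q = 0`» (generic `exactRow_iff_bsdQuotient_unit_intrinsic_split`; `rank = 2` by the
tree's 2-descent). CONDITIONAL on (γ), Castella–Sano Thm. 3, Zanarella 2.18, Howard–Zanarella, modularity, Mazur Cor. 4.1, Stein–Wuthrich Thm. 1.1, BCS
Cor. 1.3.1, GZK by name; per curve; nothing class-wide; BSD is not proved by it. [cite: GrossLMS1991, Prop. 3.7 (2)] [cite: CastellaSano2026, Thm. 3]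
[cite: SteinWuthrich2013, Thm. 1.1 (p. 1758)] [cite: BurungaleCastellaSkinner2025, Cor. 1.3.1 (p. 4)] [cite: CremonaAlgorithms1997, Table 1 (664a1)] -/
theorem exactRow_bsdQuotientUnit_intrinsic_split_at
    (h372 : GrossLMS1991.prop37_2_frobeniusCongruence)
    (h3 : Literature.NumberTheory.EllipticCurves.CastellaSano2026_kolyvaginClass_selmerDivisibility_eq_padicValNat_tamagawaProduct)
    (hZ : Literature.NumberTheory.EllipticCurves.Zanarella2019_kolyvaginClass_one_ne_zero_of_not_selmerDivisible)
    (hHZ : Literature.NumberTheory.EllipticCurves.HowardZanarella_exists_minimal_kolyvaginClass_one_selmerCard_of_ne_zero)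
    (hnf : exists_isNewformOf) (hMaz : mazur_not_dvd_maninConstant_of_odd)
    (hSW : SteinWuthrich2013_sha_inf_torsionBy_eq_bot_of_two_le_rank)
    (hBCS : BurungaleCastellaSkinner2025.cor131_padicValRat_bsd_rank_le_one)
    (hGZK : rank_eq_analyticRank_of_analyticRank_le_one)
    (p : ℕ) [hp : Fact p.Prime] (h5 : 5 ≤ p) (hp1000 : p < 1000)
    (hgood : haveI := isElliptic_c664a1; haveI := isGloballyMinimal_c664a1; ((⟨0, 0, 0, -7, 10⟩ : WeierstrassCurve ℤ).map (Int.castRingHom ℚ)).HasGoodReductionAtPrime p)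
    (hord : haveI := isElliptic_c664a1; haveI := isGloballyMinimal_c664a1; ¬ (p : ℤ) ∣ ((⟨0, 0, 0, -7, 10⟩ : WeierstrassCurve ℤ).map (Int.castRingHom ℚ)).frobeniusTrace p)
    (htower : haveI := isElliptic_c664a1; haveI := isGloballyMinimal_c664a1; ∀ n : ℕ, ((⟨0, 0, 0, -7, 10⟩ : WeierstrassCurve ℤ).map (Int.castRingHom ℚ)).HasSurjectiveModNGaloisRep (p ^ n : ℕ))
    (K : Type) [Field K] [NumberField K] (hK : IsImaginaryQuadratic K)
    (hodd : Odd (NumberField.discr K)) (hD3 : NumberField.discr K ≠ -3) (hD4 : NumberField.discr K ≠ -4)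
    (hpD : ¬ ((p : ℤ) ∣ NumberField.discr K)) (hspl : SatisfiesHeegnerHypothesis p K)
    (hH : SatisfiesHeegnerHypothesis 166 K)
    (T : WeierstrassCurve ℚ) [T.IsElliptic] [T.IsGloballyMinimal] (C : WeierstrassCurve.VariableChange ℚ)
    (hC : C • T = ((⟨0, 0, 0, -7, 10⟩ : WeierstrassCurve ℤ).map (Int.castRingHom ℚ)).quadraticTwist (NumberField.discr K : ℚ))
    (hTr : (((⟨0, 0, 0, -7, 10⟩ : WeierstrassCurve ℤ).map (Int.castRingHom ℚ)).quadraticTwist (NumberField.discr K : ℚ)).analyticRank = 1) :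
    haveI := isElliptic_c664a1; haveI := isGloballyMinimal_c664a1; haveI : NeZero (((⟨0, 0, 0, -7, 10⟩ : WeierstrassCurve ℤ).map (Int.castRingHom ℚ)).conductorNorm ℤ) := neZero_conductorNorm_of_isElliptic _;
    (∃ (Dt : ModularParametrizationData ((⟨0, 0, 0, -7, 10⟩ : WeierstrassCurve ℤ).map (Int.castRingHom ℚ)) (((⟨0, 0, 0, -7, 10⟩ : WeierstrassCurve ℤ).map (Int.castRingHom ℚ)).conductorNorm ℤ)) (β : ℤ) (ι : K →+* ℂ) (ℓ : ℕ)
      (d : KolyvaginHeegnerData Dt β ι ℓ),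
      ℓ.Prime ∧ Zhang2014.IsKolyvaginPrime (((⟨0, 0, 0, -7, 10⟩ : WeierstrassCurve ℤ).map (Int.castRingHom ℚ)).conductorNorm ℤ) ((⟨0, 0, 0, -7, 10⟩ : WeierstrassCurve ℤ).map (Int.castRingHom ℚ)) K p ℓ ∧
        d.kolyvaginClass hp.out 1 ≠ 0) ↔
    ∃ q : ℚ, T.leadingLCoeff / ((T.realPeriodRat * T.regulator : ℝ) : ℂ) = (q : ℂ) ∧ padicValRat p q = 0 := by
  haveI := isElliptic_c664a1; haveI := isGloballyMinimal_c664a1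
  haveI iNZ : NeZero (((⟨0, 0, 0, -7, 10⟩ : WeierstrassCurve ℤ).map (Int.castRingHom ℚ)).conductorNorm ℤ) := neZero_conductorNorm_of_isElliptic _
  have hHN := satisfiesHeegnerHypothesis_conductorNorm_of_rad K hH
  have hN : ((⟨0, 0, 0, -7, 10⟩ : WeierstrassCurve ℤ).map (Int.castRingHom ℚ)).conductorNorm ℤ ≤ 30000 := by
    have hdvd := WeierstrassCurve.conductorNorm_dvd_minimalDiscriminantNorm ((⟨0, 0, 0, -7, 10⟩ : WeierstrassCurve ℤ).map (Int.castRingHom ℚ))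
      (WeierstrassCurve.finite_setOf_ordMinimalDiscriminant_ne_zero_holds _)
    rw [WeierstrassCurve.minimalDiscriminantNorm_int_eq_natAbs_minimalDiscriminantInt_holds,
      Summit.BirchSwinnertonDyer.BirchSwinnertonDyer.Rank1Residual.IntModel.minimalDiscriminantInt_eq intModel] at hdvd
    exact (Nat.le_of_dvd (by decide +kernel) hdvd).trans (by decide +kernel)
  exact exactRow_iff_bsdQuotient_unit_intrinsic_split h372 h3 hZ hHZ hnf hMaz hSW hBCS hGZK _ not_hasCM Summit.BirchSwinnertonDyer.BirchSwinnertonDyer.Rank2Observatory.C664a1.mordellWeilRank_eq_two hN p h5 hp1000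
    hgood hord htower (kodairaNeron_of_five_le p h5) K hK hodd hD3 hD4 hpD hspl hHN T C hC hTr

end C664a1

namespace C916c1

/-- **INTRINSIC EXACT ROW `916c1` ON THE SPLIT CELL — «ONE KOLYVAGIN BIT ⟺ THE BSD QUOTIENT OF THE HEEGNER TWIST IS A `p`-ADIC UNIT», for EVERY
Heegner field with odd `d_K` and EVERY admissible split prime (depth table v16).** `916c1` is additive at `2` (one multiplicative prime `229`): Castella–Sano
supply. For every `5 ≤ p < 1000` good ordinary with `ρ_{E,p^n}` onto, every imaginary quadratic `K` (`d_K` odd, `∉ {−3,−4}`, `p ∤ d_K`, `p` split,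
`2` and `229` split) and ANY globally minimal model `T` of `E^{(d_K)}` with `ord_{s=1} L(E^{(d_K)}, s) = 1`: «∃ frame, Kolyvagin prime `ℓ`, datum with
`c_1(ℓ) ≠ 0`» `↔` «`∃ q`, `L'(T,1)/(Ω_T·Reg_T) = q ∧ ord_p q = 0`» (generic `exactRow_iff_bsdQuotient_unit_intrinsic_split`; `rank = 2` by the
tree's 2-descent). CONDITIONAL on (γ), Castella–Sano Thm. 3, Zanarella 2.18, Howard–Zanarella, modularity, Mazur Cor. 4.1, Stein–Wuthrich Thm. 1.1, BCS
Cor. 1.3.1, GZK by name; per curve; nothing class-wide; BSD is not proved by it. [cite: GrossLMS1991, Prop. 3.7 (2)] [cite: CastellaSano2026, Thm. 3]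
[cite: SteinWuthrich2013, Thm. 1.1 (p. 1758)] [cite: BurungaleCastellaSkinner2025, Cor. 1.3.1 (p. 4)] [cite: CremonaAlgorithms1997, Table 1 (916c1)] -/
theorem exactRow_bsdQuotientUnit_intrinsic_split_at
    (h372 : GrossLMS1991.prop37_2_frobeniusCongruence)
    (h3 : Literature.NumberTheory.EllipticCurves.CastellaSano2026_kolyvaginClass_selmerDivisibility_eq_padicValNat_tamagawaProduct)
    (hZ : Literature.NumberTheory.EllipticCurves.Zanarella2019_kolyvaginClass_one_ne_zero_of_not_selmerDivisible)
    (hHZ : Literature.NumberTheory.EllipticCurves.HowardZanarella_exists_minimal_kolyvaginClass_one_selmerCard_of_ne_zero)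
    (hnf : exists_isNewformOf) (hMaz : mazur_not_dvd_maninConstant_of_odd)
    (hSW : SteinWuthrich2013_sha_inf_torsionBy_eq_bot_of_two_le_rank)
    (hBCS : BurungaleCastellaSkinner2025.cor131_padicValRat_bsd_rank_le_one)
    (hGZK : rank_eq_analyticRank_of_analyticRank_le_one)
    (p : ℕ) [hp : Fact p.Prime] (h5 : 5 ≤ p) (hp1000 : p < 1000)
    (hgood : haveI := isElliptic_c916c1; haveI := isGloballyMinimal_c916c1; ((⟨0, 0, 0, -4, 1⟩ : WeierstrassCurve ℤ).map (Int.castRingHom ℚ)).HasGoodReductionAtPrime p)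
    (hord : haveI := isElliptic_c916c1; haveI := isGloballyMinimal_c916c1; ¬ (p : ℤ) ∣ ((⟨0, 0, 0, -4, 1⟩ : WeierstrassCurve ℤ).map (Int.castRingHom ℚ)).frobeniusTrace p)
    (htower : haveI := isElliptic_c916c1; haveI := isGloballyMinimal_c916c1; ∀ n : ℕ, ((⟨0, 0, 0, -4, 1⟩ : WeierstrassCurve ℤ).map (Int.castRingHom ℚ)).HasSurjectiveModNGaloisRep (p ^ n : ℕ))
    (K : Type) [Field K] [NumberField K] (hK : IsImaginaryQuadratic K)
    (hodd : Odd (NumberField.discr K)) (hD3 : NumberField.discr K ≠ -3) (hD4 : NumberField.discr K ≠ -4)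
    (hpD : ¬ ((p : ℤ) ∣ NumberField.discr K)) (hspl : SatisfiesHeegnerHypothesis p K)
    (hH : SatisfiesHeegnerHypothesis 458 K)
    (T : WeierstrassCurve ℚ) [T.IsElliptic] [T.IsGloballyMinimal] (C : WeierstrassCurve.VariableChange ℚ)
    (hC : C • T = ((⟨0, 0, 0, -4, 1⟩ : WeierstrassCurve ℤ).map (Int.castRingHom ℚ)).quadraticTwist (NumberField.discr K : ℚ))
    (hTr : (((⟨0, 0, 0, -4, 1⟩ : WeierstrassCurve ℤ).map (Int.castRingHom ℚ)).quadraticTwist (NumberField.discr K : ℚ)).analyticRank = 1) :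
    haveI := isElliptic_c916c1; haveI := isGloballyMinimal_c916c1; haveI : NeZero (((⟨0, 0, 0, -4, 1⟩ : WeierstrassCurve ℤ).map (Int.castRingHom ℚ)).conductorNorm ℤ) := neZero_conductorNorm_of_isElliptic _;
    (∃ (Dt : ModularParametrizationData ((⟨0, 0, 0, -4, 1⟩ : WeierstrassCurve ℤ).map (Int.castRingHom ℚ)) (((⟨0, 0, 0, -4, 1⟩ : WeierstrassCurve ℤ).map (Int.castRingHom ℚ)).conductorNorm ℤ)) (β : ℤ) (ι : K →+* ℂ) (ℓ : ℕ)
      (d : KolyvaginHeegnerData Dt β ι ℓ),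
      ℓ.Prime ∧ Zhang2014.IsKolyvaginPrime (((⟨0, 0, 0, -4, 1⟩ : WeierstrassCurve ℤ).map (Int.castRingHom ℚ)).conductorNorm ℤ) ((⟨0, 0, 0, -4, 1⟩ : WeierstrassCurve ℤ).map (Int.castRingHom ℚ)) K p ℓ ∧
        d.kolyvaginClass hp.out 1 ≠ 0) ↔
    ∃ q : ℚ, T.leadingLCoeff / ((T.realPeriodRat * T.regulator : ℝ) : ℂ) = (q : ℂ) ∧ padicValRat p q = 0 := by
  haveI := isElliptic_c916c1; haveI := isGloballyMinimal_c916c1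
  haveI iNZ : NeZero (((⟨0, 0, 0, -4, 1⟩ : WeierstrassCurve ℤ).map (Int.castRingHom ℚ)).conductorNorm ℤ) := neZero_conductorNorm_of_isElliptic _
  have hHN := satisfiesHeegnerHypothesis_conductorNorm_of_rad K hH
  have hN : ((⟨0, 0, 0, -4, 1⟩ : WeierstrassCurve ℤ).map (Int.castRingHom ℚ)).conductorNorm ℤ ≤ 30000 := by
    have hdvd := WeierstrassCurve.conductorNorm_dvd_minimalDiscriminantNorm ((⟨0, 0, 0, -4, 1⟩ : WeierstrassCurve ℤ).map (Int.castRingHom ℚ))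
      (WeierstrassCurve.finite_setOf_ordMinimalDiscriminant_ne_zero_holds _)
    rw [WeierstrassCurve.minimalDiscriminantNorm_int_eq_natAbs_minimalDiscriminantInt_holds,
      Summit.BirchSwinnertonDyer.BirchSwinnertonDyer.Rank1Residual.IntModel.minimalDiscriminantInt_eq intModel] at hdvd
    exact (Nat.le_of_dvd (by decide +kernel) hdvd).trans (by decide +kernel)
  exact exactRow_iff_bsdQuotient_unit_intrinsic_split h372 h3 hZ hHZ hnf hMaz hSW hBCS hGZK _ not_hasCM Summit.BirchSwinnertonDyer.BirchSwinnertonDyer.Rank2Observatory.C916c1.mordellWeilRank_eq_two hN p h5 hp1000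
    hgood hord htower (kodairaNeron_of_five_le p h5) K hK hodd hD3 hD4 hpD hspl hHN T C hC hTr

end C916c1

namespace C944e1

/-- **INTRINSIC EXACT ROW `944e1` ON THE SPLIT CELL — «ONE KOLYVAGIN BIT ⟺ THE BSD QUOTIENT OF THE HEEGNER TWIST IS A `p`-ADIC UNIT», for EVERY
Heegner field with odd `d_K` and EVERY admissible split prime (depth table v16).** `944e1` is additive at `2` (one multiplicative prime `59`): Castella–Sano
supply. For every `5 ≤ p < 1000` good ordinary with `ρ_{E,p^n}` onto, every imaginary quadratic `K` (`d_K` odd, `∉ {−3,−4}`, `p ∤ d_K`, `p` split,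
`2` and `59` split) and ANY globally minimal model `T` of `E^{(d_K)}` with `ord_{s=1} L(E^{(d_K)}, s) = 1`: «∃ frame, Kolyvagin prime `ℓ`, datum with
`c_1(ℓ) ≠ 0`» `↔` «`∃ q`, `L'(T,1)/(Ω_T·Reg_T) = q ∧ ord_p q = 0`» (generic `exactRow_iff_bsdQuotient_unit_intrinsic_split`; `rank = 2` by the
tree's 2-descent). CONDITIONAL on (γ), Castella–Sano Thm. 3, Zanarella 2.18, Howard–Zanarella, modularity, Mazur Cor. 4.1, Stein–Wuthrich Thm. 1.1, BCS
Cor. 1.3.1, GZK by name; per curve; nothing class-wide; BSD is not proved by it. [cite: GrossLMS1991, Prop. 3.7 (2)] [cite: CastellaSano2026, Thm. 3]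
[cite: SteinWuthrich2013, Thm. 1.1 (p. 1758)] [cite: BurungaleCastellaSkinner2025, Cor. 1.3.1 (p. 4)] [cite: CremonaAlgorithms1997, Table 1 (944e1)] -/
theorem exactRow_bsdQuotientUnit_intrinsic_split_at
    (h372 : GrossLMS1991.prop37_2_frobeniusCongruence)
    (h3 : Literature.NumberTheory.EllipticCurves.CastellaSano2026_kolyvaginClass_selmerDivisibility_eq_padicValNat_tamagawaProduct)
    (hZ : Literature.NumberTheory.EllipticCurves.Zanarella2019_kolyvaginClass_one_ne_zero_of_not_selmerDivisible)
    (hHZ : Literature.NumberTheory.EllipticCurves.HowardZanarella_exists_minimal_kolyvaginClass_one_selmerCard_of_ne_zero)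
    (hnf : exists_isNewformOf) (hMaz : mazur_not_dvd_maninConstant_of_odd)
    (hSW : SteinWuthrich2013_sha_inf_torsionBy_eq_bot_of_two_le_rank)
    (hBCS : BurungaleCastellaSkinner2025.cor131_padicValRat_bsd_rank_le_one)
    (hGZK : rank_eq_analyticRank_of_analyticRank_le_one)
    (p : ℕ) [hp : Fact p.Prime] (h5 : 5 ≤ p) (hp1000 : p < 1000)
    (hgood : haveI := isElliptic_c944e1; haveI := isGloballyMinimal_c944e1; ((⟨0, 0, 0, -19, 34⟩ : WeierstrassCurve ℤ).map (Int.castRingHom ℚ)).HasGoodReductionAtPrime p)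
    (hord : haveI := isElliptic_c944e1; haveI := isGloballyMinimal_c944e1; ¬ (p : ℤ) ∣ ((⟨0, 0, 0, -19, 34⟩ : WeierstrassCurve ℤ).map (Int.castRingHom ℚ)).frobeniusTrace p)
    (htower : haveI := isElliptic_c944e1; haveI := isGloballyMinimal_c944e1; ∀ n : ℕ, ((⟨0, 0, 0, -19, 34⟩ : WeierstrassCurve ℤ).map (Int.castRingHom ℚ)).HasSurjectiveModNGaloisRep (p ^ n : ℕ))
    (K : Type) [Field K] [NumberField K] (hK : IsImaginaryQuadratic K)
    (hodd : Odd (NumberField.discr K)) (hD3 : NumberField.discr K ≠ -3) (hD4 : NumberField.discr K ≠ -4)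
    (hpD : ¬ ((p : ℤ) ∣ NumberField.discr K)) (hspl : SatisfiesHeegnerHypothesis p K)
    (hH : SatisfiesHeegnerHypothesis 118 K)
    (T : WeierstrassCurve ℚ) [T.IsElliptic] [T.IsGloballyMinimal] (C : WeierstrassCurve.VariableChange ℚ)
    (hC : C • T = ((⟨0, 0, 0, -19, 34⟩ : WeierstrassCurve ℤ).map (Int.castRingHom ℚ)).quadraticTwist (NumberField.discr K : ℚ))
    (hTr : (((⟨0, 0, 0, -19, 34⟩ : WeierstrassCurve ℤ).map (Int.castRingHom ℚ)).quadraticTwist (NumberField.discr K : ℚ)).analyticRank = 1) :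
    haveI := isElliptic_c944e1; haveI := isGloballyMinimal_c944e1; haveI : NeZero (((⟨0, 0, 0, -19, 34⟩ : WeierstrassCurve ℤ).map (Int.castRingHom ℚ)).conductorNorm ℤ) := neZero_conductorNorm_of_isElliptic _;
    (∃ (Dt : ModularParametrizationData ((⟨0, 0, 0, -19, 34⟩ : WeierstrassCurve ℤ).map (Int.castRingHom ℚ)) (((⟨0, 0, 0, -19, 34⟩ : WeierstrassCurve ℤ).map (Int.castRingHom ℚ)).conductorNorm ℤ)) (β : ℤ) (ι : K →+* ℂ) (ℓ : ℕ)
      (d : KolyvaginHeegnerData Dt β ι ℓ),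
      ℓ.Prime ∧ Zhang2014.IsKolyvaginPrime (((⟨0, 0, 0, -19, 34⟩ : WeierstrassCurve ℤ).map (Int.castRingHom ℚ)).conductorNorm ℤ) ((⟨0, 0, 0, -19, 34⟩ : WeierstrassCurve ℤ).map (Int.castRingHom ℚ)) K p ℓ ∧
        d.kolyvaginClass hp.out 1 ≠ 0) ↔
    ∃ q : ℚ, T.leadingLCoeff / ((T.realPeriodRat * T.regulator : ℝ) : ℂ) = (q : ℂ) ∧ padicValRat p q = 0 := by
  haveI := isElliptic_c944e1; haveI := isGloballyMinimal_c944e1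
  haveI iNZ : NeZero (((⟨0, 0, 0, -19, 34⟩ : WeierstrassCurve ℤ).map (Int.castRingHom ℚ)).conductorNorm ℤ) := neZero_conductorNorm_of_isElliptic _
  have hHN := satisfiesHeegnerHypothesis_conductorNorm_of_rad K hH
  have hN : ((⟨0, 0, 0, -19, 34⟩ : WeierstrassCurve ℤ).map (Int.castRingHom ℚ)).conductorNorm ℤ ≤ 30000 := (Nat.le_of_dvd (by norm_num) conductorNorm_dvd).trans (by norm_num)
  exact exactRow_iff_bsdQuotient_unit_intrinsic_split h372 h3 hZ hHZ hnf hMaz hSW hBCS hGZK _ not_hasCM Summit.BirchSwinnertonDyer.BirchSwinnertonDyer.Rank2Observatory.C944e1.mordellWeilRank_eq_two hN p h5 hp1000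
    hgood hord htower (kodairaNeron_of_five_le p h5) K hK hodd hD3 hD4 hpD hspl hHN T C hC hTr

end C944e1

end Summit.BirchSwinnertonDyer.BirchSwinnertonDyer.Theorems.KolyvaginDepthDoor

end
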